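import Summits.Langlands.Langlands.Statement
import Literature.NumberTheory.Automorphic.ACCAutomorphyLiftingCrystalline
import HarnessLib

/-!
# On-path lemma (F4) for the rung `CrystallineLiftingCM 2` of line `CrystallineLiftingCMAllWeights`
# (crux `ReciprocityUpToIrreducibility`, item stmt-Langlands-14328; G4 ladder-down, generation 9)

`Langlands → CrystallineLiftingCM θ` for EVERY `θ` (in particular the rung `θ = 2` and the higher rung
`θ = 3`): clause (B) of the summit at any reciprocity datum — one exists by the `Nonempty` conjunct of
the Statement — applies to every `ρ` on the sector, because the sector's local clause is stated against
the PINNED Fontaine datum `fontainePstAdicCompletion v p hv`, which is `Rec.pst p v hv` by definition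
(`ReciprocityData.pst`), and crystalline ⇒ de Rham (`IsCrystallineFramed.isDeRhamFramed`), so the sector
hypotheses give `IsGeometricFramed Rec ρ`; `Corresponds Rec ι π ρ` contains a.e. Satake–Frobenius
matching in the `|det|^{(1-1)/2}`-normalisation (`m = 1`) as its first conjunct, and `π` is L-algebraic
(`T ⊗ |det|^0 = T`).  The residual, seed and numerical hypotheses are not used (that is the point of a
lifting theorem: it is a SECTOR of (B)).  Also the dial monotonicity `E(3) → E(2) → E(1)`.  The family is
VERBATIM the one of `Lines/CrystallineLiftingCMAllWeights.lean`.  Sorry-free; standard axioms.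
-/

noncomputable section

set_option linter.dupNamespace false

open scoped MatrixGroups Matrix NumberField Classical
open NumberField IsDedekindDomain Field Filter
open Literature.NumberTheory.Automorphic Literature.NumberTheory.GaloisRepresentations
open Literature.NumberTheory.PAdicHodge
open Summit.Langlands

namespace Summit.Langlands.Langlands.Cruxes.ReciprocityUpToIrreducibility.CrystallineLiftingCMAllWeights.OnPath

/-- The **labelled Hodge–Tate weight clause** of the dial, at one label: `θ = 0` — the weights are
`{0, 1, …, n-1}` (weight zero, ACC+ Thm 6.1.1 as formalised); `θ = 1` — pairwise distinct and inside
the (per-label halved) Fontaine–Laffaille window `2 (a - b) < p - 2` (implies ACC+ (5a)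
`λ_{τ,1} + λ_{τc,1} - λ_{τ,n} - λ_{τc,n} < p - 2n`); `θ ≥ 2` — pairwise distinct, NO bound. -/
def htClause (n p : ℕ) (w : Multiset ℤ) : ℕ → Prop
  | 0 => w = (Multiset.range n).map fun i : ℕ => (i : ℤ)
  | 1 => w.Nodup ∧ ∀ a ∈ w, ∀ b ∈ w, 2 * (a - b) < (p : ℤ) - 2
  | _ + 2 => w.Nodup

/-- The **local clause at `v ∣ p`** of the dial: `θ ≤ 2` — crystalline; `θ ≥ 3` — de Rham
(potentially semistable), for the PINNED Fontaine datum. -/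
def localClause {K : Type} [Field K] [NumberField K] {p : ℕ} [Fact p.Prime] {n : ℕ}
    (v : HeightOneSpectrum (𝓞 K)) (hv : ((p : ℕ) : 𝓞 K) ∈ v.asIdeal)
    (ρv : FramedRep (absoluteGaloisGroup (v.adicCompletion K)) (PadicAlgCl p) n) (θ : ℕ) : Prop :=
  if θ ≤ 2 then (fontainePstAdicCompletion v p hv).IsCrystallineFramed ρv
  else (fontainePstAdicCompletion v p hv).IsDeRhamFramed ρv

/-- The **automorphic seed clause** of the dial: the residually-automorphic seed `π` has the weight of
`ρ`: `θ = 0` — `π` has weight zero (ACC+ verbatim); `θ ≥ 1` — `π` has a regular algebraic infinity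
type `T` whose recipe `HT_σ(r_ι(π)) = hodgeTateWeights (T ⊗ |det|^{(1-n)/2}) σ` (Buzzard–Gee; cyclotomic
weight `-1`) reproduces the labelled Hodge–Tate weights of `ρ` at every `v ∣ p` and every label. -/
def seedClause {F : Type} [Field F] [NumberField F] {n : ℕ}
    {hcpt : isCompact_glFiniteIntegralLevel n F} {p : ℕ} [Fact p.Prime]
    (ι : PadicAlgCl p ≃+* ℂ) (ρ : FramedGaloisRep F (PadicAlgCl p) n)
    (π : CuspidalAutomorphicRepData n F hcpt) : ℕ → Prop
  | 0 => π.1.HasWeightZero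
  | _ + 1 => ∃ T : InfinityType F n, π.1.HasInfinityType T ∧ T.IsRegularAlgebraic ∧
      ∀ (v : HeightOneSpectrum (𝓞 F)) (hv : ((p : ℕ) : 𝓞 F) ∈ v.asIdeal),
        let D := fontainePstAdicCompletion v p hv
        letI := D.algebra
        ∀ τ' : v.adicCompletion F →ₐ[ℚ_[p]] PadicAlgCl p,
          (ρ.labelledHodgeTateWeightsAt v D.algebra D.𝔅 τ'.toRingHom).map (fun k : ℤ => (k : ℂ)) =
            (T.twist ((1 - (n : ℂ)) / 2)).hodgeTateWeights
              (ι.toRingHom.comp (τ'.toRingHom.comp (algebraMap F (v.adicCompletion F))))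

/-- **The rung family** `E(θ)` (dial = p-adic-Hodge depth of the weight/local condition at `ℓ = p` in
the Calegari–Geraghty automorphy lifting theorem for `GL_n` over an imaginary CM field, ACC+ Thm 6.1.1):
for `F` imaginary CM, `p > n²`, `p > 2n` unramified in `F` (for `θ ≤ 2`), `ρ : Γ_F → GL_n(ℚ̄_p)`
irreducible, unramified a.e., satisfying the local clause `localClause θ` and the labelled-weight clause
`htClause θ` at every `v ∣ p`, with residual representation `τ = ρ̄` absolutely irreducible, decomposed
generic, `ρ̄|Γ_{F(ζ_p)}` absolutely irreducible with enormous image and a scalar `ρ̄(σ)`, `σ ∉ Γ_{F(ζ_p)}`,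
and RESIDUALLY AUTOMORPHIC of the same weight: a cuspidal `π` (unramified above `p` when `θ ≤ 2`) with
`seedClause θ` and an HLTT-compatible `r ≡ ρ (mod 𝔪)` — conclusion: `ρ` is automorphic up to the
normalisation twist, i.e. there are a cuspidal `Π` of `GL_n(𝔸_F)` and `m : ℕ` with `Π ⊗ |det|^{(1-m)/2}`
L-algebraic and `char(ρ(Frob_v)) = arithFrobPolyOfSatake ι q_v m (Satake(Π_v))` at almost every `v`
(`m = n`: `ρ ≅ r_ι(Π)`; `m = 1`: the summit's `SatakeFrobCompatibleAt`).  `θ = 0`: weight zero —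
ACC+ Thm 6.1.1 (the tree's named fact); `θ = 1`: Fontaine–Laffaille weights — ACC+ Thm 6.1.1 for
general `λ` (print); `θ = 2`: ALL regular weights, crystalline, `p` unramified — OPEN (the rung);
`θ ≥ 3`: de Rham at `p`, any ramification — OPEN.
[cite: AllenEtAl2023, Thm. 6.1.1] [cite: CaraianiNewton2023, Thm. 4.2.15 and Rem. 5.2.3] -/
def CrystallineLiftingCM (θ : ℕ) : Prop :=
  ∀ (F : Type) [Field F] [NumberField F], IsCMField F →
    ∀ (n : ℕ) (hcpt : isCompact_glFiniteIntegralLevel n F) (p : ℕ) [Fact p.Prime],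
      0 < n → n ^ 2 < p → 2 * n < p →
      (θ ≤ 2 → Algebra.IsUnramifiedIn (𝓞 F) (Ideal.span {(p : ℤ)})) →
    ∀ (ι : PadicAlgCl p ≃+* ℂ) (ρ : FramedGaloisRep F (PadicAlgCl p) n)
      (τ : absoluteGaloisGroup F →* GL (Fin n) (padicAlgClResidueField p))
      (π : CuspidalAutomorphicRepData n F hcpt) (r : FramedGaloisRep F (PadicAlgCl p) n),
      ρ.toGaloisRep.IsIrreducible →
      (∀ᶠ v : HeightOneSpectrum (𝓞 F) in cofinite, ρ.IsUnramifiedAt v) →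
      (∀ (v : HeightOneSpectrum (𝓞 F)) (hv : ((p : ℕ) : 𝓞 F) ∈ v.asIdeal),
        localClause v hv (ρ.toLocal v) θ ∧
          (let D := fontainePstAdicCompletion v p hv
           letI := D.algebra
           ∀ τ' : v.adicCompletion F →ₐ[ℚ_[p]] PadicAlgCl p,
             htClause n p (ρ.labelledHodgeTateWeightsAt v D.algebra D.𝔅 τ'.toRingHom) θ)) →
      ρ.IsResidualRepOf (RingHom.id _) τ → IsAbsIrreducible τ → IsDecomposedGeneric τ →
      IsAbsIrreducible (τ.comp (absGaloisGroupAdjoinRootsOfUnity F p).subtype) →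
      Subgroup.IsEnormous ((absGaloisGroupAdjoinRootsOfUnity F p).map τ) →
      (∃ σ : absoluteGaloisGroup F, σ ∉ absGaloisGroupAdjoinRootsOfUnity F p ∧
        ∃ c : padicAlgClResidueField p,
          ((τ σ : GL (Fin n) (padicAlgClResidueField p)) :
            Matrix (Fin n) (Fin n) (padicAlgClResidueField p)) = c • (1 : Matrix _ _ _)) →
      seedClause ι ρ π θ → HLTT.IsCompatible π.1 ι r → r.IsResidualRepOf (RingHom.id _) τ →
      (θ ≤ 2 → ∀ v : HeightOneSpectrum (𝓞 F), ((p : ℕ) : 𝓞 F) ∈ v.asIdeal → π.1.IsUnramifiedAt v) →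
      ∃ (Pi : CuspidalAutomorphicRepData n F hcpt) (m : ℕ),
        (∃ T : InfinityType F n, Pi.1.HasInfinityType T ∧
          (T.twist ((1 - (m : ℂ)) / 2)).IsLAlgebraic) ∧
        ∀ᶠ v : HeightOneSpectrum (𝓞 F) in cofinite, ∃ α : Multiset ℂ,
          Pi.1.HasSatakeParamAt v α ∧ ρ.IsUnramifiedAt v ∧
            ρ.HasFrobCharpolyAt v (arithFrobPolyOfSatake ι v.residueCard m α)

/-- **THE RUNG** (the filed statement): the family at `θ = 2` — Calegari–Geraghty automorphy lifting
for `GL_n` over imaginary CM fields in ALL regular crystalline weights (`p` unramified, `p > n²`), i.e.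
ACC+ Thm 6.1.1 with the Fontaine–Laffaille weight bound (5a) removed. -/
def CrystallineLiftingCMAllWeights : Prop := CrystallineLiftingCM 2

/-! ## Dial monotonicity inside the typed range -/

/-- `E(2) → E(1)`: all weights ⇒ Fontaine–Laffaille weights (drop the window). -/
theorem mono_two_one (h : CrystallineLiftingCM 2) : CrystallineLiftingCM 1 := by
  intro F _ _ hCM n hcpt p _ hn hn2 h2n hunrp ι ρ τ π r hirr hunr hloc hres hτ hdg hζ henorm hσ
    hseed hcomp hresr hπp
  refine h F hCM n hcpt p hn hn2 h2n (fun _ => hunrp (by norm_num)) ι ρ τ π r hirr hunr ?_ hres hτ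
    hdg hζ henorm hσ hseed hcomp hresr (fun _ => hπp (by norm_num))
  intro v hv
  obtain ⟨h1, h2⟩ := hloc v hv
  refine ⟨by simpa [localClause] using h1, fun τ' => (h2 τ').1⟩

/-- `E(3) → E(2)`: de Rham with any ramification ⇒ crystalline with `p` unramified. -/
theorem mono_three_two (h : CrystallineLiftingCM 3) : CrystallineLiftingCM 2 := by
  intro F _ _ hCM n hcpt p _ hn hn2 h2n hunrp ι ρ τ π r hirr hunr hloc hres hτ hdg hζ henorm hσ
    hseed hcomp hresr hπp
  refine h F hCM n hcpt p hn hn2 h2n (fun h3 => absurd h3 (by norm_num)) ι ρ τ π r hirr hunr ?_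
    hres hτ hdg hζ henorm hσ hseed hcomp hresr (fun h3 => absurd h3 (by norm_num))
  intro v hv
  obtain ⟨h1, h2⟩ := hloc v hv
  have h1' : (fontainePstAdicCompletion v p hv).IsCrystallineFramed (ρ.toLocal v) := by
    simpa [localClause] using h1
  exact ⟨by simpa [localClause] using h1'.isDeRhamFramed, fun τ' => h2 τ'⟩

/-! ## On-path: the summit gives every rung -/

/-- Twisting an infinity type by `0` does nothing. -/
theorem twist_zero' {F : Type} [Field F] {n : ℕ} (T : InfinityType F n) : T.twist 0 = T := by
  funext σ
  simp [InfinityType.twist]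

/-- **ON-PATH** (F4): `Langlands → E(θ)` for EVERY `θ` — clause (B) of the summit at any reciprocity
datum (one exists by the `Nonempty` conjunct) applies to every `ρ` on the sector: the local clause is
stated against the PINNED Fontaine datum `fontainePstAdicCompletion v p hv = Rec.pst p v hv` (`rfl`),
crystalline ⇒ de Rham, so the sector hypotheses give `IsGeometricFramed Rec ρ`; `Corresponds Rec ι π ρ`
contains a.e. Satake–Frobenius matching with `m = 1`, and `π` is L-algebraic (`T ⊗ |det|^0 = T`).
The residual / seed / numerical hypotheses are simply not used. -/
theorem crystallineLiftingCM_of_langlands (θ : ℕ) (hL : _root_.Langlands) :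
    CrystallineLiftingCM θ := by
  intro F _ _ _hCM n hcpt p _ hn _hn2 _h2n _hunrp ι ρ τ π r hirr hunr hloc _hres _hτ _hdg _hζ
    _henorm _hσ _hseed _hcomp _hresr _hπp
  obtain ⟨⟨Rec⟩, hall⟩ := hL F
  have hB : GaloisToAutomorphic n Rec hcpt := (hall Rec n hn hcpt).2
  have hdR : ∀ (v : HeightOneSpectrum (𝓞 F)) (hv : ((p : ℕ) : 𝓞 F) ∈ v.asIdeal),
      (Rec.pst p v hv).IsDeRhamFramed (ρ.toLocal v) := by
    intro v hv
    change (fontainePstAdicCompletion v p hv).IsDeRhamFramed (ρ.toLocal v)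
    have h1 := (hloc v hv).1
    by_cases hθ : θ ≤ 2
    · have h1' : (fontainePstAdicCompletion v p hv).IsCrystallineFramed (ρ.toLocal v) := by
        simpa [localClause, hθ] using h1
      exact h1'.isDeRhamFramed
    · simpa [localClause, hθ] using h1
  have hgeo : IsGeometricFramed Rec ρ := ⟨hunr, hdR⟩
  obtain ⟨Pi, ⟨T, hT, hTL⟩, hcorr⟩ := hB p ι ρ hirr hgeo
  refine ⟨Pi, 1, ⟨T, hT, ?_⟩, ?_⟩
  · have h0 : ((1 - ((1 : ℕ) : ℂ)) / 2) = 0 := by norm_num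
    rw [h0, twist_zero']
    exact hTL
  · exact hcorr.1

/-- **F4 on-path lemma for the rung**: `Langlands → CrystallineLiftingCMAllWeights`. -/
@[aesop safe apply]
theorem CrystallineLiftingCMAllWeights_of_Langlands (hL : _root_.Langlands) :
    CrystallineLiftingCMAllWeights :=
  crystallineLiftingCM_of_langlands 2 hL

end Summit.Langlands.Langlands.Cruxes.ReciprocityUpToIrreducibility.CrystallineLiftingCMAllWeights.OnPath

end
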